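/-
Copyright: project-internal (b2b / free-splitting certificates, generation 8).
-/
import Summits.AtomisticToContinuum.Crystallization.Theorems.FreeSplittingCertificatesRadiusLadderGroupAvg

/-!
# The octahedral point group `O_h` as 48 signed coordinate permutations — the symmetry the
recurrent-pattern LP actually quotients by

`FreeSplittingCertificatesRadiusLadderGroupAvg` proved, for an ARBITRARY nonempty finite set `G` of linear
isometries of `ℝ³` closed under composition, that `RungAt δ R` may without loss of generality be witnessed by a
`G`-invariant splitting rule and that a zoo defeating every `G`-invariant rule refutes the rung
(`rungAt_iff_exists_invariant`, `not_rungAt_of_zoo_invariant`).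

The recurrent-pattern LP of the `lj-lp` lane (RESULTS-R2 §1, LP_FORMAT.md) keys bond classes modulo the
hyperoctahedral group `O_h` = the 48 signed permutations of the three frame coordinates.  This file supplies that
concrete instance: `signPerm σ s` (flip the signs flagged by `s`, then permute coordinates by `σ`), the finite set
`octahedral` of all of them (exactly 48: `octahedral_card`, via `signPerm_injective`), its composition law and
closure (`signPerm_trans`, `trans_mem_octahedral`), `±1 ∈ octahedral`, and the corollaries the certificates rely
on, now with NO free group parameter:

* `rungAt_iff_exists_octahedral_invariant` — the rung holds iff an `O_h`-invariant feasible rule exists;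
* `not_rungAt_of_zoo_octahedral` — a δ-separated zoo on which every `O_h`-invariant rule has a deficient site
  refutes `RungAt δ R` (soundness of an `O_h`-keyed Farkas certificate, cf. `…RadiusLadderFarkas`);
* `octahedral_invariant_eq_half` — an `O_h`-invariant rule gives weight exactly `1/2` to a bond whose reversed key
  lies in its `O_h`-orbit (the LP's "self-complementary" classes).

Honest framing (speedrun cell b2b-freesplit, build tag lj-lp): this is a theorem about WHAT THE LP CERTIFICATES
DECIDE, not progress on the summit; the R = 2 verdict (rung not refuted) is unchanged by it.
-/

namespace Summit.AtomisticToContinuum.Crystallization.Theorems.StrictSplittingRuleBirth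

open scoped BigOperators

local notation "E3" => EuclideanSpace ℝ (Fin 3)

noncomputable section

/-- The sign isometry of `ℝ` selected by a Boolean flag (`true` = negate). [folklore] -/
def signIso (b : Bool) : ℝ ≃ₗᵢ[ℝ] ℝ :=
  if b then LinearIsometryEquiv.neg ℝ (E := ℝ) else LinearIsometryEquiv.refl ℝ ℝ

/-- Pointwise action of `signIso`. [folklore] -/
@[simp] theorem signIso_apply (b : Bool) (t : ℝ) : signIso b t = (if b then -t else t) := by
  unfold signIso; cases b <;> simp

/-- The signed coordinate permutation `(σ, s)`: flip the coordinates flagged by `s`, then permute coordinates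
by `σ` (coordinate `j` moves to position `σ j`). [folklore] -/
def signPerm (σ : Equiv.Perm (Fin 3)) (s : Fin 3 → Bool) : E3 ≃ₗᵢ[ℝ] E3 :=
  (LinearIsometryEquiv.piLpCongrRight 2 fun i => signIso (s i)).trans
    (LinearIsometryEquiv.piLpCongrLeft 2 ℝ ℝ σ)

/-- Coordinates of `signPerm σ s x`: position `i` carries `± x (σ⁻¹ i)`. [folklore] -/
@[simp] theorem signPerm_apply (σ : Equiv.Perm (Fin 3)) (s : Fin 3 → Bool) (x : E3) (i : Fin 3) :
    signPerm σ s x i = (if s (σ.symm i) then -x (σ.symm i) else x (σ.symm i)) := by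
  simp [signPerm, LinearIsometryEquiv.trans_apply, LinearIsometryEquiv.piLpCongrLeft_apply,
    Equiv.piCongrLeft'_apply]

/-- The octahedral group `O_h`: all signed coordinate permutations of `ℝ³` (48 of them), as a finite set of
linear isometries. [folklore] -/
def octahedral : Finset (E3 ≃ₗᵢ[ℝ] E3) := by
  classical
  exact Finset.univ.image fun p : Equiv.Perm (Fin 3) × (Fin 3 → Bool) => signPerm p.1 p.2

/-- Every signed permutation belongs to `octahedral`. [folklore] -/
theorem signPerm_mem_octahedral (σ : Equiv.Perm (Fin 3)) (s : Fin 3 → Bool) : signPerm σ s ∈ octahedral := by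
  classical
  unfold octahedral
  exact Finset.mem_image.mpr ⟨(σ, s), Finset.mem_univ _, rfl⟩

/-- Membership in `octahedral` = being some signed permutation. [folklore] -/
theorem mem_octahedral_iff {g : E3 ≃ₗᵢ[ℝ] E3} :
    g ∈ octahedral ↔ ∃ (σ : Equiv.Perm (Fin 3)) (s : Fin 3 → Bool), signPerm σ s = g := by
  classical
  unfold octahedral
  simp only [Finset.mem_image, Finset.mem_univ, true_and, Prod.exists]

/-- `octahedral` is nonempty (it contains the identity). [folklore] -/
theorem octahedral_nonempty : octahedral.Nonempty :=
  ⟨_, signPerm_mem_octahedral (Equiv.refl (Fin 3)) fun _ => false⟩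

/-- The identity is the unsigned trivial permutation. [folklore] -/
theorem signPerm_refl_false : signPerm (Equiv.refl (Fin 3)) (fun _ => false) = LinearIsometryEquiv.refl ℝ E3 :=
  LinearIsometryEquiv.ext fun x => PiLp.ext fun i => by simp

/-- Point inversion `−1` is the fully signed trivial permutation. [folklore] -/
theorem signPerm_refl_true : signPerm (Equiv.refl (Fin 3)) (fun _ => true) = LinearIsometryEquiv.neg ℝ :=
  LinearIsometryEquiv.ext fun x => PiLp.ext fun i => by simp

/-- `1 ∈ O_h`. [folklore] -/
theorem refl_mem_octahedral : LinearIsometryEquiv.refl ℝ E3 ∈ octahedral :=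
  signPerm_refl_false ▸ signPerm_mem_octahedral _ _

/-- `−1 ∈ O_h` (point inversion). [folklore] -/
theorem neg_mem_octahedral : LinearIsometryEquiv.neg ℝ ∈ octahedral :=
  signPerm_refl_true ▸ signPerm_mem_octahedral _ _

/-- Composition law of signed permutations: `(σ, s)` then `(τ, t)` is `(σ.trans τ, j ↦ s j xor t (σ j))`.
[folklore] -/
theorem signPerm_trans (σ τ : Equiv.Perm (Fin 3)) (s t : Fin 3 → Bool) :
    (signPerm σ s).trans (signPerm τ t) = signPerm (σ.trans τ) fun j => xor (s j) (t (σ j)) := by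
  refine LinearIsometryEquiv.ext fun x => PiLp.ext fun i => ?_
  simp only [LinearIsometryEquiv.trans_apply, signPerm_apply, Equiv.symm_trans_apply,
    Equiv.apply_symm_apply]
  cases s (σ.symm (τ.symm i)) <;> cases t (τ.symm i) <;> simp

/-- `O_h` is closed under composition. [folklore] -/
theorem trans_mem_octahedral : ∀ g ∈ octahedral, ∀ h ∈ octahedral, g.trans h ∈ octahedral := by
  intro g hg h hh
  obtain ⟨σ, s, rfl⟩ := mem_octahedral_iff.mp hg
  obtain ⟨τ, t, rfl⟩ := mem_octahedral_iff.mp hh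
  rw [signPerm_trans]
  exact signPerm_mem_octahedral _ _

/-- Distinct labels give distinct isometries (test vector `(1, 2, 3)`), so `octahedral` has exactly
`3! · 2³ = 48` elements. [folklore] -/
theorem signPerm_injective {σ τ : Equiv.Perm (Fin 3)} {s t : Fin 3 → Bool}
    (h : signPerm σ s = signPerm τ t) : σ = τ ∧ s = t := by
  let x : E3 := WithLp.toLp 2 fun k : Fin 3 => (k : ℝ) + 1
  have hxk : ∀ k : Fin 3, x k = (k : ℝ) + 1 := fun k => rfl
  have key : ∀ i : Fin 3, σ.symm i = τ.symm i ∧ s (σ.symm i) = t (τ.symm i) := by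
    intro i
    have hi := congrArg (fun g : E3 ≃ₗᵢ[ℝ] E3 => g x i) h
    simp only [signPerm_apply, hxk] at hi
    have ha : (0 : ℝ) ≤ ((σ.symm i : ℕ) : ℝ) := Nat.cast_nonneg _
    have hb : (0 : ℝ) ≤ ((τ.symm i : ℕ) : ℝ) := Nat.cast_nonneg _
    cases hs : s (σ.symm i) <;> cases ht : t (τ.symm i) <;> simp only [hs, ht, if_true, if_false,
      Bool.false_eq_true] at hi
    · exact ⟨Fin.ext (Nat.cast_injective (R := ℝ) (by linarith)), rfl⟩
    · exact absurd hi (by linarith)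
    · exact absurd hi (by linarith)
    · exact ⟨Fin.ext (Nat.cast_injective (R := ℝ) (by linarith)), rfl⟩
  have hστ : σ = τ := by
    have : σ.symm = τ.symm := Equiv.ext fun i => (key i).1
    simpa using congrArg Equiv.symm this
  refine ⟨hστ, funext fun j => ?_⟩
  have := (key (σ j)).2
  rwa [← hστ, Equiv.symm_apply_apply] at this

/-- `|O_h| = 3! · 2³ = 48`. [folklore] -/
theorem octahedral_card : octahedral.card = 48 := by
  classical
  unfold octahedral
  rw [Finset.card_image_of_injective]
  · simp only [Finset.card_univ, Fintype.card_prod, Fintype.card_perm, Fintype.card_fin,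
      Fintype.card_pi, Fintype.card_bool, Finset.prod_const]
    decide
  · rintro ⟨σ, s⟩ ⟨τ, t⟩ h
    obtain ⟨h1, h2⟩ := signPerm_injective h
    exact Prod.ext h1 h2

/-! ## The corollaries used by the `O_h`-keyed certificates -/

/-- WLOG `O_h`-INVARIANCE: the radius-`R` rung holds iff it is witnessed by a splitting rule invariant under all
48 signed coordinate permutations. [folklore] -/
theorem rungAt_iff_exists_octahedral_invariant (δ R : ℝ) :
    RungAt δ R ↔ ∃ Φ : E3 → Finset E3 → ℝ, IsRule Φ ∧ Feasible δ R Φ ∧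
      ∀ g ∈ octahedral, ∀ (v : E3) (T : Finset E3), Φ (g v) (T.image g) = Φ v T :=
  rungAt_iff_exists_invariant octahedral_nonempty trans_mem_octahedral δ R

/-- SOUNDNESS OF THE `O_h`-KEYED LP AS A REFUTER: a finite δ-separated zoo on which every `O_h`-invariant rule
leaves some site below `eInf` refutes `RungAt δ R` (the zoo itself need not be `O_h`-closed). [folklore] -/
theorem not_rungAt_of_zoo_octahedral {δ R : ℝ} (Z : Finset (Σ N : ℕ, Fin N → E3))
    (hZ : ∀ c ∈ Z, Sep δ c.2)
    (h : ∀ Φ : E3 → Finset E3 → ℝ, IsRule Φ →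
      (∀ g ∈ octahedral, ∀ (v : E3) (T : Finset E3), Φ (g v) (T.image g) = Φ v T) →
      ∃ c ∈ Z, ∃ i : Fin c.1, siteE R Φ c.2 i < eInf) :
    ¬ RungAt δ R :=
  not_rungAt_of_zoo_invariant octahedral_nonempty trans_mem_octahedral Z hZ h

/-- SELF-COMPLEMENTARY CLASSES: an `O_h`-invariant rule gives weight exactly `1/2` to a bond `(v, T)` whose
reversed key `(−v, T − v)` is the image of `(v, T)` under some signed permutation. [folklore] -/
theorem octahedral_invariant_eq_half {Φ : E3 → Finset E3 → ℝ} (hr : IsRule Φ)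
    (hinv : ∀ g ∈ octahedral, ∀ (v : E3) (T : Finset E3), Φ (g v) (T.image g) = Φ v T)
    {v : E3} (hv : v ≠ 0) {T : Finset E3} {g : E3 ≃ₗᵢ[ℝ] E3} (hg : g ∈ octahedral)
    (hgv : g v = -v) (hgT : T.image g = T.image fun u => u - v) : Φ v T = 1 / 2 :=
  invariant_eq_half hr hinv hv hg hgv hgT

/-- In particular (take `g = −1 ∈ O_h`): an `O_h`-invariant rule is midpoint-symmetric — centrosymmetric joint
patterns get weight `1/2` (cf. `invAvg_eq_half`). -/
example {Φ : E3 → Finset E3 → ℝ} (hr : IsRule Φ)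
    (hinv : ∀ g ∈ octahedral, ∀ (v : E3) (T : Finset E3), Φ (g v) (T.image g) = Φ v T)
    {v : E3} (hv : v ≠ 0) {T : Finset E3}
    (hT : T.image (LinearIsometryEquiv.neg ℝ : E3 ≃ₗᵢ[ℝ] E3) = T.image fun u => u - v) : Φ v T = 1 / 2 :=
  octahedral_invariant_eq_half hr hinv hv neg_mem_octahedral (by simp) hT

end

end Summit.AtomisticToContinuum.Crystallization.Theorems.StrictSplittingRuleBirth
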